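import Summits.QuantumFields.BalabanUV.T4Continuum.Spine.NE1p.DressedWindowScheduleWin
import Summits.QuantumFields.BalabanUV.T4Continuum.Spine.NE1p.DressedUniformConstants
import Summits.QuantumFields.BalabanUV.T4Continuum.Support.T4TrajectoryDensityWitnessK2

/-!
# T⁴ programme, spine estimate NE1′ (node O3b/H2) — FUNCTION-LEVEL NON-VACUITY AT EVERY CUTOFF WITH ONE K-FREE `U` AND ONE
# CUTOFF-FREE SCHEDULE: the window-face pipeline END-F-win → S1d → S3 → END-B → ROOT exercised on a toy TOWER, part 1 of 2
# (formalisation crew `b2b-balaban-t4-ne1p-formalise-*`, leaf seat 03, generation 2, row W5; own-initiative consistency item,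
# NOT a crew estimate row)

Cell `pub-balaban`, sub-cell `t4`, BINDER-OWNERS row NE1′ (owner lineage t4-ne1p-p1; root `Spine/NE1p/DressedRoot.lean`,
p211416).  ADDITIVE — imports leaf-04's `Spine/NE1p/DressedWindowScheduleWin` (row S1d: `WindowScheduleWin`,
`transportLeaf_win_of_schedule`, the cutoff-free `WindowScheduleWin.geometric`, p213367), leaf-09's
`Spine/NE1p/DressedUniformConstants` (row S3: `uniformConstantsCell`, `bookingLeavesCell`, `dressedStability_of_cell`, p212599) and
the lineage's toy calculus `Support/T4TrajectoryDensityWitnessK2` (`ev₀₀`, `e₀₀`, `base₁`, `discs_subset_ball`, `norm_t_mul_le`,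
p195847) ONLY; modifies nothing.
Part 2 = `Spine/NE1p/DressedTowerWitnessEnd.lean` (END-F-win, END-B and the ROOT by name on the data of this part).

WHY.  The trigger's non-vacuity check (t5) is met at BOOKING level for every cutoff with ONE `U` (`DressedRootWitness`), and at
FUNCTION level for `K = 2` only (rows W1 `DressedTransportWitness`, W2 `DressedTransportAssembledWitness*`, W3).  Caveat k1 and the
located findings LF-1 ∕ LF-2 ask whether the FUNCTION-level binder families can be inhabited at ALL cutoffs by K-free data.  On
the WINDOW face (END-F-win + a per-step-window schedule) they can: this part builds, for every cutoff `K`, ONE datum on `Fld 4 ℂ`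
meeting every displayed binder of `DressedWindowScheduleWin.transportLeaf_win_of_schedule` along ONE cutoff-free schedule
`Wg := WindowScheduleWin.geometric 1 1 ψ ¼ 1 0` (leaf-04; windows `bondBall (c_W ψ^k)`, fluctuation radii `ψ^k∕4`, chart radius
`1`, chart windows `ψ^k∕2`) and ONE set of cell scalars (`L := 2·alphaCell ½ = 6e³`, `ψ := L⁻²`, `C = 4c_δ∕r = 2`, `c̄ = 0`,
`κ = ½`, `N₀ = A₀ = 1`, `m = ¼`, `s̄⁰ = ρ′ = ½`; the located largeness `locCell L C c̄ κ = ½ = ρ′` holds by the CHOICE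
`L := 2·alphaCell κ` — no numeral «Bałaban's L», k2).  Nothing displayed depends on `K` except the birth amplitude
`a_K = τ^K ∕ (C·(c_W + 3))`, `τ = L⁻³` — which IS the class.

THE DATUM (cutoff `K`).  Booking `BW K`: one family born at scale `0`, felt at one cube of every scale, POSITIVE booked size
`a_K·δ_k` at scale `k` with `δ_k := ψ^k∕2` (the transverse defect, at the transport rate, inside the chart window `ψ^k∕2`);
trajectory `TW K` (`gen = a_K·(c_W + 3)·[k′ = 0]`, `lin b 0 k = a_K·δ_k`); carried functionals `FnW K b 0 k U = a_K·(U₀₀ + shift k)`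
(later generations `0`) with `shift (k+1) = shift k + ψ^k∕8` — `hFn` holds AS AN EQUATION for the two-atom fluctuation measure
`δ_0 + δ_{z_k}`, `z_k ≡ ψ^k∕4 ∈ bondBall (σ k)` (a genuine averaging step: the accumulated dressing `shift`); ACTION exponent
`𝒜 ≡ 0`, observable exponent `𝒬 ≡ q ≡ 0`, `base ≡ 1`, `ref = id`, `rel = Eq`, `z₀ = 0`, no regeneration, action margins `s ≡ 0`,
live families `S k b = {b}`.  DEGENERATE WHERE DECLARED: the weight binders `hB` ∕ `hE` ∕ `hP` are inhabited by CONSTANTS here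
(their non-trivial joint inhabitation is W1 ∕ W2's, at `K = 2`); non-degenerate: positive sizes at every `(K, k)`, the averaging
step, the transport rate `ψ = L⁻²` visible in `lin`, attainment `hlin` PROVED from the functionals along the gauge direction
`δ_k·e₀₀`, defects inside the shrinking per-step windows, (w4) from the schedule's cutoff-free ratio.

WHAT IT IS NOT.  Not an estimate; nothing of Bałaban's densities or of [Balaban1989LargeFieldII] (1.71)–(1.75) pp. 379–380 is
encoded (CONTEXT only, carried by the imported headers); no `def … : Prop`; every declaration is [folklore] toy kernel mathematics,
0 sorry, 0 citations.  It says NOTHING about whether the cell's D-terms meet the shapes (the wall (w1)–(w7) of the record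
`t4/T4-EST-NE1p-P1.md` §4 is unchanged); LF-2 stands: the cutoff-freeness here is for the window face WITH `hP` DISPLAYED (and
discharged by a constant) — an ASSEMBLED `hP` costs `K·w` in the birth window until row S1e «slice-win».  VALUE = a
joint-satisfiability certificate, uniform in the cutoff, for END-F-win's displayed binders ∪ END-B's per-cutoff leaf binders with
ONE K-free `U` preceding `∀ K` (k1's quantifier order exercised at function level).

HONEST FRAMING.  Rung (B)+1 bookkeeping on ONE finite four-torus of fixed physical size — NOT infinite volume, NOT a mass gap, NOT
OS on ℝ⁴, NOT the Clay problem, NOT summit progress.  NE1′ is NOT PRINTED and NOT PROVED; every headline reads «NE1′ ⇐ the named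
binders»; spine PROVED 0∕9 unchanged.  HONEST DEPENDENCY: continuum YM on T⁴ ⇐ BetaPertH ∧ nine spine estimates (0/9 proved);
BetaPertH ⇐ (D1) ∧ (D4) ∧ CAP+tail; G-an2-4 gates asym, D1 and NE2/3/4.
-/

noncomputable section

namespace Summit.QuantumFields.BalabanUV.T4Continuum.NE1p.DressedTowerWitness

open MeasureTheory Set Metric Filter Finset
open scoped BigOperators
open Literature.MathematicalPhysics.QuantumFieldTheory.Balaban1983to89
open Literature.MathematicalPhysics.QuantumFieldTheory.Balaban1983to89.T4TermFormat
open Literature.MathematicalPhysics.QuantumFieldTheory.Balaban1983to89.T4TermFormat.Booking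
open Literature.MathematicalPhysics.QuantumFieldTheory.Balaban1983to89.T4GatedBooking
open Literature.MathematicalPhysics.QuantumFieldTheory.Balaban1983to89.T4TrajectoryComparison
open T4TrajectoryModulus (bondBall bondBall_add_mem bondBall_latMove_add_mem bondBall_diam)
open T4BlockTransport (Fld NDir latMove latN Site norm_dir_le)
open T4BirthChartTransport (GaugeInvariant BirthSlice RelGauge)
open T4TrajectoryDensity
open Summit.QuantumFields.BalabanUV.T4Continuum.T4TrajectoryDensityDressed
open Summit.QuantumFields.BalabanUV.T4Continuum.T4TrajectoryDensityWitness
open Summit.QuantumFields.BalabanUV.T4Continuum.NE1p.DressedRoot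
open Summit.QuantumFields.BalabanUV.T4Continuum.NE1p.DressedUniformConstants
open Summit.QuantumFields.BalabanUV.T4Continuum.NE1p.DressedWindowScheduleWin

/-! ## §1 The K-free scalars: `L := 2·alphaCell ½`, `ψ := L⁻²`, the cutoff-free schedule [folklore] -/

/-- The cell's block size, CHOSEN so that the located largeness holds with `ρ′ = ½`: `L := 2·alphaCell ½ = 6e³`
(a choice for the toy — NOT Bałaban's `L`, no numeral from print). [folklore] -/
def LW : ℝ := 2 * alphaCell (1 / 2)

/-- [arith] [folklore] `L ≥ 2` (`alphaCell ½ = 3e³ ≥ 1`). -/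
theorem two_le_LW : 2 ≤ LW := by
  have h : Real.exp 3 ≤ alphaCell (1 / 2) := exp_three_le_alphaCell (by norm_num)
  have h1 : (1 : ℝ) ≤ Real.exp 3 := Real.one_le_exp (by norm_num)
  unfold LW; linarith

/-- [arith] [folklore] `1 ≤ L`. -/
theorem one_le_LW : 1 ≤ LW := by linarith [two_le_LW]

/-- [arith] [folklore] `0 < L`. -/
theorem LW_pos : 0 < LW := by linarith [two_le_LW]

/-- [arith] [folklore] The transverse rate `ψ = L⁻²` is positive. -/
theorem psi_pos : 0 < (LW ^ 2)⁻¹ := by have := LW_pos; positivity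

/-- [arith] [folklore] `ψ = L⁻² < 1`. -/
theorem psi_lt_one : (LW ^ 2)⁻¹ < 1 := inv_lt_one_of_one_lt₀ (by nlinarith [two_le_LW])

/-- [arith] [folklore] `ψ ≤ 1`. -/
theorem psi_le_one : (LW ^ 2)⁻¹ ≤ 1 := psi_lt_one.le

/-- [arith] [folklore] Powers of `ψ` are in `(0, 1]`. -/
theorem psi_pow_le_one (k : ℕ) : ((LW ^ 2)⁻¹) ^ k ≤ 1 := pow_le_one₀ psi_pos.le psi_le_one

/-- [arith] [folklore] The located largeness holds by the choice of `L`: `locCell L C 0 ½ = ½` for EVERY `C`. -/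
theorem locCell_LW (C : ℝ) : locCell LW C 0 (1 / 2) = 1 / 2 := by
  have hα : 0 < alphaCell (1 / 2) := alphaCell_pos (by norm_num)
  unfold locCell LW
  field_simp
  ring

/-- **THE ONE CUTOFF-FREE SCHEDULE** [decided toy]: leaf-04's geometric per-step-window schedule with ratio `ψ`, `σ₀ = ¼`,
chart radius `1`, final window `0`; birth radius `r = 1`, slice window `w = 1`. [folklore] -/
def Wg : WindowScheduleWin 1 1 :=
  WindowScheduleWin.geometric 1 1 ((LW ^ 2)⁻¹) (1 / 4) 1 0 psi_pos psi_lt_one (by norm_num) (by norm_num) one_pos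

/-- The birth-window radius `c_W = (1 + 2ψ)·¼∕(1 − ψ)` (cutoff-free). [folklore] -/
def cW : ℝ := (1 + 2 * (LW ^ 2)⁻¹) * (1 / 4) / (1 - (LW ^ 2)⁻¹)

/-- [arith] [folklore] `0 < c_W`. -/
theorem cW_pos : 0 < cW := by
  have h1 := psi_pos; have h2 := psi_lt_one
  unfold cW
  exact div_pos (by positivity) (by linarith)

/-- [arith] [folklore] The schedule's fields, unfolded. -/
theorem Wg_ρw (k : ℕ) : Wg.ρw k = cW * ((LW ^ 2)⁻¹) ^ k := by
  show 0 + (1 + 2 * (LW ^ 2)⁻¹) * (1 / 4) / (1 - (LW ^ 2)⁻¹) * ((LW ^ 2)⁻¹) ^ k = _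
  rw [zero_add]; rfl

/-- [arith] [folklore] -/ theorem Wg_σ (k : ℕ) : Wg.σ k = 1 / 4 * ((LW ^ 2)⁻¹) ^ k := rfl
/-- [arith] [folklore] -/ theorem Wg_ϱc (k : ℕ) : Wg.ϱc k = 1 := rfl
/-- [arith] [folklore] -/ theorem Wg_wc (k : ℕ) : Wg.wc k = 2 * (1 / 4) * ((LW ^ 2)⁻¹) ^ k := rfl

/-- [arith] [folklore] The birth window is `bondBall c_W`. -/
theorem Wg_ρw_zero : Wg.ρw 0 = cW := by rw [Wg_ρw, pow_zero, mul_one]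

/-- [folklore] The zero background lies in every window, at every step of every cutoff. -/
theorem zero_mem_window (k : ℕ) : (0 : Fld 4 ℂ) ∈ (bondBall 4 (Wg.ρw k) : Set (Fld 4 ℂ)) :=
  WindowScheduleWin.geometric_zero_mem_window (r := 1) psi_pos psi_lt_one (by norm_num) (by norm_num) one_pos le_rfl k

/-! ## §2 The two-atom fluctuation measures `δ_0 + δ_{z_k}` and their calculus [folklore] -/

/-- The second atom at step `k`: the constant bond field `ψ^k∕4` (inside `bondBall (σ k)`). [folklore] -/
def atomW (k : ℕ) : Fld 4 ℂ := fun _ _ => ((((LW ^ 2)⁻¹) ^ k / 4 : ℝ) : ℂ)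

/-- The fluctuation measure with atoms `0` and `a`. [folklore] -/
def flAt (a : Fld 4 ℂ) : Measure (Fld 4 ℂ) := Measure.dirac 0 + Measure.dirac a

/-- [folklore] -/ @[simp] theorem ev₀₀_atomW (k : ℕ) : ev₀₀ (atomW k) = ((((LW ^ 2)⁻¹) ^ k / 4 : ℝ) : ℂ) := rfl

/-- Almost everywhere for the two-atom measure = at both atoms. [folklore] -/
theorem ae_flAt {a : Fld 4 ℂ} {p : Fld 4 ℂ → Prop} : (∀ᵐ z ∂flAt a, p z) ↔ p 0 ∧ p a := by
  unfold flAt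
  rw [ae_add_measure_iff, ae_dirac_eq, ae_dirac_eq]
  simp [Filter.eventually_pure]

/-- Modulo a Dirac mass every function is a.e. equal to its value at the atom. [folklore] -/
private theorem aeeq_dirac {E : Type*} (a : Fld 4 ℂ) (f : Fld 4 ℂ → E) : f =ᵐ[Measure.dirac a] fun _ => f a := by
  rw [Filter.EventuallyEq, ae_dirac_eq]; simp

section Calculus

variable {E : Type*} [NormedAddCommGroup E]

/-- Every function is integrable against a two-atom measure. [folklore] -/
theorem integrable_flAt (a : Fld 4 ℂ) (f : Fld 4 ℂ → E) : Integrable f (flAt a) :=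
  ((integrable_const (f 0)).congr (aeeq_dirac 0 f).symm).add_measure
    ((integrable_const (f a)).congr (aeeq_dirac a f).symm)

/-- Every function is a.e.-strongly measurable for a two-atom measure. [folklore] -/
theorem aesm_flAt (a : Fld 4 ℂ) (f : Fld 4 ℂ → E) : AEStronglyMeasurable f (flAt a) := (integrable_flAt a f).1

/-- The integral against a two-atom measure is the sum of the two values. [folklore] -/
theorem integral_flAt [NormedSpace ℝ E] [CompleteSpace E] (a : Fld 4 ℂ) (f : Fld 4 ℂ → E) :
    ∫ z, f z ∂flAt a = f 0 + f a := by
  unfold flAt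
  rw [integral_add_measure ((integrable_const (f 0)).congr (aeeq_dirac 0 f).symm)
    ((integrable_const (f a)).congr (aeeq_dirac a f).symm),
    integral_congr_ae (aeeq_dirac 0 f), integral_congr_ae (aeeq_dirac a f)]
  simp

end Calculus

/-- Every complex function is in the integrand class of a two-atom measure. [folklore] -/
theorem mem_bddClass_flAt (a : Fld 4 ℂ) (f : Fld 4 ℂ → ℂ) : f ∈ BddClass ℂ (flAt a) :=
  ⟨aesm_flAt a f, max ‖f 0‖ ‖f a‖, ae_flAt.mpr ⟨le_max_left _ _, le_max_right _ _⟩⟩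

/-- The trivial exponent `≡ 0` (action part AND observable part of the toy). [folklore] -/
def zeroExp : Fld 4 ℂ → Fld 4 ℂ → ℂ := fun _ _ => 0

/-- With `base ≡ 1` and exponent `0 + 0` the weight is `≡ 1`. [folklore] -/
theorem expWeight_zero (U : Fld 4 ℂ) : expWeight base₁ (zeroExp + zeroExp) U = fun _ => 1 := by
  funext z; simp [expWeight_apply, base₁, zeroExp]

/-- **THE DRESSED OPERATION IN CLOSED FORM**: with trivial weights the two-atom operation is the plain average
`wOp … U h = (h 0 + h z_k)∕2` — a genuine averaging step. [folklore] -/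
theorem wOp_flAt (a U : Fld 4 ℂ) (h : Fld 4 ℂ → ℂ) :
    wOp (expWeight base₁ (zeroExp + zeroExp)) (flAt a) 0 U h = 2⁻¹ * (h 0 + h a) := by
  have hint : ∫ z, expWeight base₁ (zeroExp + zeroExp) U z ∂flAt a = 2 := by
    rw [expWeight_zero, integral_flAt]; norm_num
  rw [wOp_of_pos (integrable_flAt a _) (by rw [hint]; norm_num), hint, integral_flAt]
  simp only [expWeight_zero, smul_eq_mul, one_mul]

/-! ## §3 The datum at cutoff `K`: booking, trajectory, carried functionals, directions [decided toy] -/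

/-- The transverse defect at scale `k`: `δ_k = ψ^k∕2` (at the transport rate, inside the chart window `wc k = ψ^k∕2`). [folklore] -/
def defW (k : ℕ) : ℝ := 1 / 2 * ((LW ^ 2)⁻¹) ^ k

/-- [arith] [folklore] -/ theorem defW_pos (k : ℕ) : 0 < defW k := by unfold defW; have := psi_pos; positivity

/-- The birth amplitude at cutoff `K`: `a_K = τ^K ∕ (C·(c_W + 3))` with `τ = L⁻³`, `C = 2` — the source decay, i.e. the class. [folklore] -/
def aK (K : ℕ) : ℝ := (LW⁻¹ ^ 3) ^ K / (2 * (cW + 3))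

/-- [arith] [folklore] -/
theorem aK_pos (K : ℕ) : 0 < aK K := by
  unfold aK; have := LW_pos; have := cW_pos; positivity

/-- TOY BOOKING at cutoff `K` [decided toy]: one observable-attached family, born at scale `0`, felt at one cube of every scale,
with POSITIVE size `a_K·δ_k` at scale `k`.  Nothing of Bałaban's is modelled. [folklore] -/
def BW (K : ℕ) : T4TermFormat.Booking where
  K := K
  Dom := Unit
  domScale := fun _ => 0
  treeLen := fun _ => 0
  treeLen_nonneg := fun _ => le_rfl
  balSize := fun _ => 0
  Birth := Unit
  births := {()}
  mem_births := fun b => by simp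
  birthScale := fun _ => 0
  birth_le := fun _ => Nat.zero_le K
  loc := fun _ => ()
  loc_scale := fun _ => rfl
  Cube := Fin (K + 1)
  cubes := Finset.univ
  mem_cubes := fun q => Finset.mem_univ q
  cubeScale := fun q => q.val
  cube_le := fun q => Nat.lt_succ_iff.mp q.isLt
  feltAt := fun _ => {()}
  felt_birth_le := fun _ _ _ => Nat.zero_le _
  size := fun _ k => aK K * defW k
  size_nonneg := fun _ k => (mul_pos (aK_pos K) (defW_pos k)).le
  pair := fun _ _ _ => 0

/-- TOY TRAJECTORY at cutoff `K` [decided toy]: one generation (the birth, size `a_K·(c_W + 3)` = the sup of the birth functional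
over the slices of the birth window), re-linearised size `a_K·δ_k` = the booked size. [folklore] -/
def TW (K : ℕ) : Trajectory (BW K) where
  lin := fun _ k' k => if k' = 0 then aK K * defW k else 0
  lin_nonneg := fun _ k' k => by
    split_ifs
    · exact (mul_pos (aK_pos K) (defW_pos k)).le
    · exact le_rfl
  gen := fun _ k' => if k' = 0 then aK K * (cW + 3) else 0
  gen_nonneg := fun _ k' => by
    split_ifs
    · exact (mul_pos (aK_pos K) (by linarith [cW_pos])).le
    · exact le_rfl
  size_le := fun b k _ _ => by
    show aK K * defW k ≤ ∑ k' ∈ Icc 0 k, (if k' = 0 then aK K * defW k else 0)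
    rw [Finset.sum_ite_eq' (Icc 0 k) 0 (fun _ => aK K * defW k)]
    simp

/-- TOY TOWER [decided toy]: the datum at every cutoff (one run parameter). [folklore] -/
def towerW : DressedTower Unit where
  B := fun _ K => BW K
  K_eq := fun _ _ => rfl
  T := fun _ K => TW K

/-- The accumulated dressing of the carried functional: `shift 0 = 0`, `shift (k+1) = shift k + ψ^k∕8`. [folklore] -/
def shiftW : ℕ → ℂ
  | 0 => 0
  | k + 1 => shiftW k + ((((LW ^ 2)⁻¹) ^ k / 8 : ℝ) : ℂ)

/-- THE CARRIED FUNCTIONALS at cutoff `K` [decided toy]: generation `0` at scale `k` is `a_K·(U₀₀ + shift k)`; later generations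
are absent (`0`). [folklore] -/
def FnW (K : ℕ) (k' k : ℕ) (U : Fld 4 ℂ) : ℂ := if k' = 0 then (aK K : ℂ) * (ev₀₀ U + shiftW k) else 0

/-- `hFn` AS AN EQUATION: the step `k → k+1` is the dressed operation with trivial weights on the two-atom measure
`δ_0 + δ_{z_k}` applied to the translates. [folklore] -/
theorem FnW_succ (K k' k : ℕ) (U : Fld 4 ℂ) :
    FnW K k' (k + 1) U = wOp (expWeight base₁ (zeroExp + zeroExp)) (flAt (atomW k)) 0 U (fun z => FnW K k' k (U + z)) := by
  rw [wOp_flAt]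
  by_cases h : k' = 0
  · subst h
    simp only [FnW, ↓reduceIte, shiftW, ev₀₀_add, ev₀₀_atomW, add_zero]
    push_cast; ring
  · simp [FnW, h]

/-- The gauge direction of step `k`: `δ_k·e₀₀` with declared bound `δ_k`. [folklore] -/
def dirW (k : ℕ) : NDir 4 ℂ := fldDir (((defW k : ℝ) : ℂ) • e₀₀) (defW k) fun x ν => by
  rw [Pi.smul_apply, Pi.smul_apply, norm_smul, Complex.norm_real, Real.norm_eq_abs, abs_of_pos (defW_pos k)]
  calc defW k * ‖e₀₀ x ν‖ ≤ defW k * 1 := mul_le_mul_of_nonneg_left (norm_e₀₀_le x ν) (defW_pos k).le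
    _ = defW k := mul_one _

/-- [folklore] -/ theorem latN_dirW (k : ℕ) : latN (dirW k) = defW k := rfl

/-- [folklore] Moving `0` by `1` along `dirW k` lands at `U₀₀ = δ_k`. -/
theorem ev₀₀_move_dirW (k : ℕ) : ev₀₀ (latMove 0 (dirW k) 1) = ((defW k : ℝ) : ℂ) := by
  rw [ev₀₀_latMove]
  show ev₀₀ 0 + 1 * ev₀₀ (((defW k : ℝ) : ℂ) • e₀₀) = _
  rw [ev₀₀_smul, ev₀₀_e₀₀, ev₀₀_zero]; ring

end Summit.QuantumFields.BalabanUV.T4Continuum.NE1p.DressedTowerWitness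

end
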